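/-
Copyright: cell pub-balaban-gaps (YM BLITZ Y1, track G1), seat g1-p2 GEN 5 (unit `pub-balaban-gaps-g1-p2`).  Row (D4) NODE O,
OBJECT ∕ MECHANISM level: [B9] (3.88)–(3.89)'s `K(h_□) = O(M⁻¹)` AS A LEMMA in the block currency — the commutator of a
FINITE-RANGE operator with a `1∕M`-LIPSCHITZ partition function has block norm `≤ (r₁∕M)·‖K′‖_{y,y′}` and blocks near the support
(the prior programme's `Beta/UnitLatticeWalkInversion.wrs_Rem` mechanism *"the commutator gains the partition's Lipschitz factor
1∕M"*, unit `b2b-balaban-beta-d4-p3` 2026-08-20, PORTED to `blockNorm`), fed into `D4WalkBlockParametrix`: the Neumann margin's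
smallness letter becomes `1∕M` LITERALLY at fixed `(C_K, C_L, r₁, geometry)`.
HONEST FRAMING: mechanism over hypothesis letters; Bałaban's `Δ^{(k)}` (its finite range ∕ block bound `C_K` on the unit lattice)
and `h_□` are NOT constructed; (D4) NOT discharged (instance 0∕1); NOT BetaPertH, NOT continuum, NOT Clay.
-/
import Summits.QuantumFields.BalabanUV.Gaps.D4WalkBlockParametrix

/-!
# `Gaps.D4WalkBlockCommutator` — (3.88): `‖[h_□, K′]‖_{y,y′} ≤ (r₁∕M)‖K′‖_{y,y′}`, blocks near `supp h_□`; the parametrix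
margin is `O(1∕M)` (cell pub-balaban-gaps, seat g1-p2 gen 5)

HONEST DEPENDENCY (cell pub-balaban, verbatim): continuum YM on T⁴ ⇐ BetaPertH ∧ nine spine estimates (0/9 proved);
BetaPertH ⇐ (D1) ∧ (D4) ∧ CAP+tail.

[B9] p. 409 (3.88)–(3.89): `Δ′(h_□G′_□h_□) = h_□² + K(h_□)G′_□h_□`, *"|(K(h_□)G′_□h_□λ)(x)| ≤ O(M⁻¹)e^{−δ₀d(y,y′)}|λ|"*;
p. 414: the commutator terms are *"of the order O(M⁻¹), or O(M⁻²), if considered on a proper scale"*; [II] (1.11) p. 5 and the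
partition of [B5]: `|∇h_□| ≤ O(M⁻¹)`.  In matrix form `K(h_□) = h_□K′ − K′h_□` has entries `(h_□(i) − h_□(j))K′(i,j)`
(`UnitLatticeWalkInversion.comm_apply`), so a site pseudo-distance `ds` with `|h_□(i) − h_□(j)| ≤ ds(i,j)∕M` (Lipschitz) and
`K′(u)(i,j) = 0` unless `ds(i,j) ≤ r₁` (finite range) give `|K(h_□)(i,j)| ≤ (r₁∕M)|K′(i,j)|` entrywise, hence
* §1 `blockNorm_comm_le`: `‖K(h_□)(u)‖_{y,y′} ≤ (r₁∕M)·‖K′(u)‖_{y,y′}` (row masses inherit the entrywise factor);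
* §2 `comm_blocks_subset`: the blocks of `K(h_□)(u)` lie in `dom □ × dom □` once `dom □` contains the cubes of the
  `r₁`-neighbourhood of `supp h_□` (`exists_entry_of_blockNorm_ne_zero` + support bookkeeping);
* §3 `blockWalkExpansion_parametrix_lipschitz`: `D4WalkBlockParametrix.blockWalkExpansion_parametrix` with the commutator
  letters DISCHARGED — Thm 3.10 at one scale in block currency from: local-inverse block bound `C_L` + holomorphy, `K′`
  holomorphic with block bound `C_K` and range `r₁`, partition `|h| ≤ 1`, `1∕M`-Lipschitz, supports + neighbourhoods inside the
  domains, geometry, cube row sum; Neumann margin `q = c_μ(c_μ·1·(1·K̄_R)c_μ)c_μ`,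
  `K̄_R = (n_C·(r₁∕M·C_K)·C_L)e^{κ₁m_J}e^{2ρ₀r}e^{μr}n_Dc_μ` — **`O(1∕M)` at fixed letters: "M sufficiently large" LITERALLY**.
WHAT IT IS NOT: Bałaban's `Δ^{(k)}` as a finite-range unit-lattice operator with a k-UNIFORM block bound `C_K` and his `G′_□`
with Cor 3.6 bounds are NOT constructed (letters `hKbd`, `hKrange`, `hLbd`); multi-scale, (v), `TermDomination` remain; (D4)
instance 0∕1; words UNCHANGED.
-/

noncomputable section

namespace Summit.QuantumFields.BalabanUV.Gaps.D4WalkBlockCommutator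

open Metric Set Finset
open Literature.MathematicalPhysics.QuantumFieldTheory.Balaban1983to89
open Literature.MathematicalPhysics.QuantumFieldTheory.Balaban1983to89.B9SectDWalk (Through MajSumLe DomBy)
open Literature.MathematicalPhysics.QuantumFieldTheory.Balaban1983to89.B9Thm34Ext (toB6)
open Literature.MathematicalPhysics.QuantumFieldTheory.Balaban1983to89.B9Thm37GlueTorus (torusGeom tdist1 tdist1_nonneg)
open Literature.MathematicalPhysics.QuantumFieldTheory.Balaban1983to89.TreeLengthTorus (TPt)
open Literature.MathematicalPhysics.QuantumFieldTheory.Balaban1983to89.B5TorusCover (UT)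
open Literature.MathematicalPhysics.QuantumFieldTheory.Balaban1983to89.B11SectG (RowSum)
open Literature.MathematicalPhysics.QuantumFieldTheory.Balaban1983to89.B13DomainKernelWalks (DomainTerms)
open Summit.QuantumFields.BalabanUV.Gaps.D4WalkBlock
  (rowMass blockNorm blockNorm_nonneg rowMass_nonneg rowMass_le_blockNorm blockNorm_le_of_rowMass_le BlockWalkExpansion)
open Summit.QuantumFields.BalabanUV.Gaps.D4WalkBlockParametrix (blockWalkExpansion_parametrix)
open Summit.QuantumFields.BalabanUV.T4Continuum.Spine.NE5.TwoRunPencilDomains (withOp)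
open Summit.QuantumFields.BalabanUV.Beta.UnitLatticeWalkInversion (Hd Pj comm_apply)

/-! ## §1. The commutator's block norm: the Lipschitz factor `r₁∕M` -/

section Comm

variable {ν : ℕ} {K : Fin ν → ℕ}
variable {n : Type} [Fintype n] [DecidableEq n] {B : Type}
variable (cubn : n → UT K)

omit [DecidableEq n] in
/-- A non-zero block has a non-zero entry in it. [folklore] -/
theorem exists_entry_of_blockNorm_ne_zero {p : Type} [Fintype p] (cub : p → UT K) (T : Matrix p n ℂ) {y y' : UT K}
    (h : blockNorm cub cubn T y y' ≠ 0) : ∃ i j, cub i = y ∧ cubn j = y' ∧ T i j ≠ 0 := by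
  by_contra hne
  push Not at hne
  apply h
  refine le_antisymm (blockNorm_le_of_rowMass_le cub cubn T y y' le_rfl fun i hi => le_of_eq ?_) (blockNorm_nonneg _ _ _ _ _)
  unfold rowMass
  exact Finset.sum_eq_zero fun j hj => by rw [hne i j hi (Finset.mem_filter.1 hj).2, norm_zero]

/-- **ENTRYWISE**: `|K(h_□)(i,j)| ≤ (r₁∕M)·|K′(i,j)|` for a `1∕M`-Lipschitz `h_□` and a range-`r₁` kernel `K′`.
[cite: Balaban1985BackgroundPropagators, (3.88)–(3.89) p.409, p.414] -/
theorem norm_comm_apply_le (h : B → n → ℝ) (ds : n → n → ℝ) {M r₁ : ℝ} (hM : 0 < M)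
    (hLip : ∀ b i j, |h b i - h b j| ≤ ds i j / M) (K' : Matrix n n ℂ) (hKrange : ∀ i j, K' i j ≠ 0 → ds i j ≤ r₁)
    (b : B) (i j : n) : ‖(Hd h b * K' - K' * Hd h b) i j‖ ≤ r₁ / M * ‖K' i j‖ := by
  rw [comm_apply, norm_mul]
  by_cases hK : K' i j = 0
  · rw [hK, norm_zero, mul_zero, mul_zero]
  · refine mul_le_mul_of_nonneg_right ?_ (norm_nonneg _)
    rw [← Complex.ofReal_sub, Complex.norm_real, Real.norm_eq_abs]
    exact (hLip b i j).trans (div_le_div_of_nonneg_right (hKrange i j hK) hM.le)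

/-- **BLOCK NORM OF THE COMMUTATOR**: `‖h_□K′ − K′h_□‖_{y,y′} ≤ (r₁∕M)·‖K′‖_{y,y′}` — print's `K(h_□) = O(M⁻¹)`, the prior
engine's `wrs_Rem` Lipschitz gain in block currency. [cite: Balaban1985BackgroundPropagators, (3.88)–(3.89) p.409, p.414; Balaban1988RG2Cluster, (1.11) p.5] -/
theorem blockNorm_comm_le (h : B → n → ℝ) (ds : n → n → ℝ) {M r₁ : ℝ} (hM : 0 < M) (hr₁ : 0 ≤ r₁)
    (hLip : ∀ b i j, |h b i - h b j| ≤ ds i j / M) (K' : Matrix n n ℂ) (hKrange : ∀ i j, K' i j ≠ 0 → ds i j ≤ r₁)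
    (b : B) (y y' : UT K) :
    blockNorm cubn cubn (Hd h b * K' - K' * Hd h b) y y' ≤ r₁ / M * blockNorm cubn cubn K' y y' := by
  refine blockNorm_le_of_rowMass_le cubn cubn _ y y' (mul_nonneg (div_nonneg hr₁ hM.le) (blockNorm_nonneg _ _ _ _ _))
    fun i hi => ?_
  calc rowMass cubn (Hd h b * K' - K' * Hd h b) i y' ≤ r₁ / M * rowMass cubn K' i y' := by
        unfold rowMass
        rw [Finset.mul_sum]
        exact Finset.sum_le_sum fun j _ => norm_comm_apply_le h ds hM hLip K' hKrange b i j
    _ ≤ r₁ / M * blockNorm cubn cubn K' y y' :=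
        mul_le_mul_of_nonneg_left (hi ▸ rowMass_le_blockNorm cubn cubn K' i y') (div_nonneg hr₁ hM.le)

/-! ## §2. The commutator's blocks sit near the support of `h_□` -/

/-- **SUPPORT OF THE COMMUTATOR**: if `supp h_□ ⊆ Es □`, `K′` has range `r₁` in a symmetric pseudo-distance with `ds(i,i) ≤ r₁`,
and `dom □` contains the cube of every site within `r₁` of `Es □`, then the blocks of `h_□K′ − K′h_□` lie in `dom □ × dom □`
(print: `K(h_□)` is localized near `supp ∇h_□ ⊂ □̃`). [cite: Balaban1985BackgroundPropagators, (3.87)–(3.88) p.409] -/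
theorem comm_blocks_subset (h : B → n → ℝ) (Es : B → Finset n) (hsupp : ∀ b y, y ∉ Es b → h b y = 0)
    (ds : n → n → ℝ) {r₁ : ℝ} (hsymm : ∀ i j, ds i j = ds j i) (hself : ∀ i, ds i i ≤ r₁)
    (K' : Matrix n n ℂ) (hKrange : ∀ i j, K' i j ≠ 0 → ds i j ≤ r₁)
    (dom : B → Finset (UT K)) (hdomE : ∀ b i, (∃ k ∈ Es b, ds i k ≤ r₁) → cubn i ∈ dom b)
    (b : B) (y y' : UT K) (hne : blockNorm cubn cubn (Hd h b * K' - K' * Hd h b) y y' ≠ 0) : y ∈ dom b ∧ y' ∈ dom b := by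
  obtain ⟨i, j, hi, hj, hij⟩ := exists_entry_of_blockNorm_ne_zero cubn cubn _ hne
  rw [comm_apply] at hij
  have hK : K' i j ≠ 0 := fun h0 => hij (by rw [h0, mul_zero])
  have hd : ds i j ≤ r₁ := hKrange i j hK
  have hh : h b i ≠ h b j := fun e => hij (by rw [e, sub_self, zero_mul])
  -- one of i, j is in the support
  have hmem : i ∈ Es b ∨ j ∈ Es b := by
    by_contra hno
    push Not at hno
    exact hh (by rw [hsupp b i hno.1, hsupp b j hno.2])
  subst hi; subst hj
  rcases hmem with hiE | hjE
  · exact ⟨hdomE b i ⟨i, hiE, hself i⟩, hdomE b j ⟨i, hiE, by rw [hsymm]; exact hd⟩⟩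
  · exact ⟨hdomE b i ⟨j, hjE, hd⟩, hdomE b j ⟨j, hjE, hself j⟩⟩

end Comm

/-! ## §3. The parametrix of `D4WalkBlockParametrix` with the commutator letters discharged: margin `O(1∕M)` -/

section Parametrix

variable {d N' : ℕ} {ν : ℕ} {K : Fin ν → ℕ} [∀ i, NeZero (K i)]
variable {n : Type} [Fintype n] [DecidableEq n]
variable {E : Type*} [NormedAddCommGroup E] [NormedSpace ℂ E]
variable {L : DomainTerms d N' ν K n n E} {h : L.B → n → ℝ} {Es : L.B → Finset n} {K' : E → Matrix n n ℂ}
variable {ds : n → n → ℝ}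
variable {c : B13.Consts} {cubn : n → UT K} {X : Finset (UT K)} {R CL CK M r₁ r : ℝ} {mJ nD nC : ℕ}
variable {ρ₀ ε₀ κ₀ μ cμ : ℝ}

/-- **THEOREM 3.10 AT ONE SCALE, BLOCK CURRENCY, MARGIN `O(1∕M)`**: the hypotheses of `blockWalkExpansion_parametrix` with the
two commutator letters REPLACED by their sources — `K′(u)` of range `r₁` (in a symmetric site pseudo-distance with
`ds(i,i) ≤ r₁`) with block bound `C_K` on the ball, `h_□` `1∕M`-Lipschitz, `dom □` containing the cubes of the `r₁`-neighbourhood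
of `Es □` — so that `λ_K = (r₁∕M)·C_K` (§1–§2): the σ-decorated glued family is a `BlockWalkExpansion` with
`K̄_R = (n_C·(r₁∕M·C_K)·C_L)e^{κ₁m_J}e^{2ρ₀r}e^{μr}n_Dc_μ` in the margin — at fixed `(C_K, C_L, r₁, r, m_J, n_D, n_C, μ, c_μ)` the
condition `q < 1` reads `M ≥ M₀`. [cite: Balaban1985BackgroundPropagators, Thm 3.7 (3.87)–(3.90) p.409, Cor 3.8 p.410, Thm 3.10 p.416, p.414; Balaban1988RG2Cluster, (1.11) p.5, p.13, p.15] -/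
theorem blockWalkExpansion_parametrix_lipschitz
    (hanchor : ∀ b, L.anchor b ∈ L.dom b) (hdiam : ∀ b, ∀ z ∈ L.dom b, ∀ z' ∈ L.dom b, tdist1 K z z' ≤ r)
    (hJ : ∀ b, (L.J b).card ≤ mJ) (hX : ∀ b, (L.J b).Nonempty → (L.dom b ∩ X).Nonempty)
    (hmult : ∀ z : UT K, (Finset.univ.filter fun b => L.anchor b = z).card ≤ nD)
    (hsupp : ∀ b y, y ∉ Es b → h b y = 0) (habs : ∀ b y, |h b y| ≤ 1) (hE : ∀ b y, y ∈ Es b → cubn y ∈ L.dom b)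
    (hLan : ∀ b i j, DifferentiableOn ℂ (fun u => L.op b u i j) (ball (0 : E) R))
    (hLbd : ∀ b, ∀ u ∈ ball (0 : E) R, ∀ y y', blockNorm cubn cubn (L.op b u) y y' ≤ CL) (hCL : 0 ≤ CL)
    (hKan : ∀ i j, DifferentiableOn ℂ (fun u => K' u i j) (ball (0 : E) R))
    (hKbd : ∀ u ∈ ball (0 : E) R, ∀ y y', blockNorm cubn cubn (K' u) y y' ≤ CK) (hCK : 0 ≤ CK)
    (hM : 0 < M) (hr₁ : 0 ≤ r₁) (hsymm : ∀ i j, ds i j = ds j i) (hself : ∀ i, ds i i ≤ r₁)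
    (hLip : ∀ b i j, |h b i - h b j| ≤ ds i j / M) (hKrange : ∀ u i j, K' u i j ≠ 0 → ds i j ≤ r₁)
    (hdomE : ∀ b i, (∃ k ∈ Es b, ds i k ≤ r₁) → cubn i ∈ L.dom b)
    (hcard : ∀ b, (L.dom b).card ≤ nC)
    (hκ₁ : 0 ≤ c.κ₁) (hμ : 0 ≤ μ) (hμε : 3 * μ ≤ ε₀) (hμκ : 2 * μ ≤ κ₀) (hwin : κ₀ + μ ≤ ρ₀ - ε₀) (hcμ : 0 ≤ cμ)
    (hrow : RowSum (toB6 (torusGeom K 0 0 0) 0 True) μ cμ)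
    (hq : cμ * (cμ * 1 *
      (1 * (((nC * (r₁ / M * CK) * CL) * Real.exp (c.κ₁ * mJ) * Real.exp (2 * ρ₀ * r)) * Real.exp (μ * r) * (nD * cμ))) *
        cμ) * cμ < 1) :
    ∃ (W : Type) (T : W → (TPt d N' → ℂ) → E → Matrix n n ℂ) (SX : Set W) (A : W → ℝ) (D : W → UT K → UT K → ℝ)
      (ρ' : ℝ), BlockWalkExpansion c cubn cubn
        (fun σ₀ u => (withOp L fun b u => Hd h b * L.op b u * Hd h b).kernel σ₀ u *
          ((1 : Matrix n n ℂ) + (-1 : ℂ) •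
            (withOp L fun b u => (Hd h b * K' u - K' u * Hd h b) * L.op b u * Hd h b).kernel σ₀ u)⁻¹)
        X R (ε₀ - 3 * μ) (κ₀ - 2 * μ)
        (cμ * ((CL * Real.exp (c.κ₁ * mJ) * Real.exp (2 * ρ₀ * r)) * Real.exp (μ * r) * (nD * cμ)) *
          (1 * (1 - cμ * (cμ * 1 *
            (1 * (((nC * (r₁ / M * CK) * CL) * Real.exp (c.κ₁ * mJ) * Real.exp (2 * ρ₀ * r)) * Real.exp (μ * r) *
              (nD * cμ))) * cμ) * cμ)⁻¹) * cμ)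
        T SX A D ρ' ∧
      ∀ ω, DomBy (toB6 (torusGeom K 0 0 0) 0 True) (D ω) :=
  blockWalkExpansion_parametrix hanchor hdiam hJ hX hmult hsupp habs hE hLan hLbd hCL hKan
    (fun b u hu y y' => (blockNorm_comm_le cubn h ds hM hr₁ hLip (K' u) (hKrange u) b y y').trans
      (mul_le_mul_of_nonneg_left (hKbd u hu y y') (div_nonneg hr₁ hM.le)))
    (mul_nonneg (div_nonneg hr₁ hM.le) hCK)
    (fun b u y y' hne => comm_blocks_subset cubn h Es hsupp ds hsymm hself (K' u) (hKrange u) L.dom hdomE b y y' hne)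
    hcard hκ₁ hμ hμε hμκ hwin hcμ hrow hq

end Parametrix

end Summit.QuantumFields.BalabanUV.Gaps.D4WalkBlockCommutator

end
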